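import Summits.CriticalPhenomena.CardyFormulaZ2.Theorems.CardyRotToConfR2SymmetryUpgrade.Negative.SurgFatGerm
import Summits.CriticalPhenomena.CardyFormulaZ2.Theorems.CardyRotToConfR2SymmetryUpgrade.Negative.SurgRayChord
import Summits.CriticalPhenomena.CardyFormulaZ2.Theorems.CardyRotToConfR2SymmetryUpgrade.Negative.SurgCrosscutDomain
import Mathlib.MeasureTheory.Measure.Lebesgue.EqHaar
import HarnessLib

/-!
# The chord of a firing Dobrushin domain and its crosscut domain
# (fat-germ one-shot surgery for crux `CardyRotToConfR2SymmetryUpgrade`, stmt-CriticalPhenomena-0698)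

For a Dobrushin domain `(D; a, b)` whose germ at `a` fires, the surgery runs the straight CHORD
from `a` in the firing direction up to its first exit point `q = firePt D ∈ ∂D` (`fireChord D`,
length `fireExit D`; exit data from `SurgRayChord` with the auxiliary point `fireTip D = a + fireDir`)
and, when `q ≠ b`, continues in the crosscut domain `fireDom D` (marks `(q, b)`). Main statements:
`fireExit_pos`, `firePt_mem_frontier`, `fireChord_mem_carrier`, `isCrosscut_fireChord`,
`remainingDomain_fireChord`, `volume_segment`, `not_fires_fireDom` (the crosscut domain never
re-fires: the chord side of `q` is a null component of the punctured boundary accumulating at `q`).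
Negative lane: no Theses statement is asserted.
-/
noncomputable section

open Set Filter Topology Metric MeasureTheory
open scoped unitInterval

namespace Summit.CriticalPhenomena.CardyFormulaZ2.Theorems.CardyRotToConfR2SymmetryUpgrade.Negative

open Literature.Probability.RandomPlanarGeometry Literature.Topology.PlaneTopology

/-! ### Exit data of a ray, without round-germ hypotheses -/

section Exit

variable {U : Set ℂ} {a m : ℂ}

/-- The exit set of a bounded set is nonempty. [folklore] -/
theorem exitSet_nonempty' (hb : Bornology.IsBounded U) (h : m ≠ a) :
    {t : ℝ | 0 < t ∧ rayPt a m t ∉ U}.Nonempty := by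
  obtain ⟨M, hM⟩ := hb.subset_ball a
  refine ⟨max M 1, lt_max_of_lt_right one_pos, fun hmem => ?_⟩
  have := hM hmem
  rw [mem_ball, dist_rayPt h, abs_of_pos (lt_max_of_lt_right one_pos)] at this
  exact absurd (le_max_left M 1) (not_le.2 this)

/-- If an initial open piece of the ray lies in `U`, the exit parameter is positive. [folklore] -/
theorem exitParam_pos' (hb : Bornology.IsBounded U) (h : m ≠ a) {ρ : ℝ} (hρ : 0 < ρ)
    (hin : ∀ t : ℝ, 0 < t → t < ρ → rayPt a m t ∈ U) : 0 < exitParam U a m := by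
  refine hρ.trans_le (le_csInf (exitSet_nonempty' hb h) fun t ht => ?_)
  by_contra hlt
  exact ht.2 (hin t ht.1 (not_le.1 hlt))

/-- The exit point is not in the open set `U`. [folklore] -/
theorem exitPt_notMem' (hU : IsOpen U) (hb : Bornology.IsBounded U) (h : m ≠ a) :
    rayPt a m (exitParam U a m) ∉ U := by
  have hmem : exitParam U a m ∈ closure {t : ℝ | 0 < t ∧ rayPt a m t ∉ U} :=
    csInf_mem_closure (exitSet_nonempty' hb h) ⟨0, fun s hs => hs.1.le⟩
  have hcl : closure {t : ℝ | 0 < t ∧ rayPt a m t ∉ U} ⊆ rayPt a m ⁻¹' Uᶜ :=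
    closure_minimal (fun t ht => ht.2) (hU.isClosed_compl.preimage continuous_rayPt)
  exact hcl hmem

/-- The exit point lies on the frontier of `U` (positive exit parameter). [folklore] -/
theorem exitPt_mem_frontier' (hU : IsOpen U) (hb : Bornology.IsBounded U) (h : m ≠ a)
    (hpos : 0 < exitParam U a m) : rayPt a m (exitParam U a m) ∈ frontier U := by
  rw [frontier_eq_closure_inter_closure]
  refine ⟨?_, subset_closure (exitPt_notMem' hU hb h)⟩
  have htend : Tendsto (rayPt a m) (𝓝[<] exitParam U a m) (𝓝 (rayPt a m (exitParam U a m))) :=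
    (continuous_rayPt (a := a) (m := m)).continuousAt.tendsto.mono_left nhdsWithin_le_nhds
  refine mem_closure_of_tendsto htend ?_
  filter_upwards [Ioo_mem_nhdsLT hpos] with t ht
  exact rayPt_mem_of_lt ht.1 ht.2

end Exit

/-! ### The chord of a firing Dobrushin domain -/

section Chord

variable (D : DobrushinDomain)

/-- The auxiliary ray point `a + fireDir` (so `dir a (fireTip D)` is the firing direction). [folklore] -/
def fireTip : ℂ := D.pt 0 + fireDir D.carrier (D.pt 0)

/-- The length of the surgery chord (exit parameter of the ray from `a` along `fireDir`). [folklore] -/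
def fireExit : ℝ := exitParam D.carrier (D.pt 0) (fireTip D)

/-- The landing point `q ∈ ∂D` of the surgery chord. [folklore] -/
def firePt : ℂ := rayPt (D.pt 0) (fireTip D) (fireExit D)

/-- **The surgery chord** from `a = D.pt 0` to `firePt D`. [folklore] -/
def fireChord : Curve ℂ := chordCurve (D.pt 0) (fireTip D) (fireExit D)

variable {D}

/-- `fireTip D - a = fireDir`. [folklore] -/
theorem fireTip_sub : fireTip D - D.pt 0 = fireDir D.carrier (D.pt 0) := by
  rw [fireTip, add_sub_cancel_left]

variable (h : Fires D.carrier (D.pt 0))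
include h

/-- The auxiliary point differs from `a`. [folklore] -/
theorem fireTip_ne : fireTip D ≠ D.pt 0 := fun heq =>
  h.fireDir_ne_zero (by rw [← fireTip_sub (D := D), heq, sub_self])

/-- The ray direction towards the auxiliary point is the firing direction. [folklore] -/
theorem dir_fireTip : dir (D.pt 0) (fireTip D) = fireDir D.carrier (D.pt 0) := by
  rw [dir, fireTip_sub, h.norm_fireDir]
  simp

/-- Ray points in the firing direction. [folklore] -/
theorem rayPt_fireTip (t : ℝ) : rayPt (D.pt 0) (fireTip D) t = D.pt 0 + (t : ℂ) * fireDir D.carrier (D.pt 0) := by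
  rw [rayPt, dir_fireTip h]

/-- **The chord has positive length.** [folklore] -/
theorem fireExit_pos : 0 < fireExit D := by
  obtain ⟨ρ, hρ, hin⟩ := h.exists_add_mul_fireDir_mem
  refine exitParam_pos' D.isBounded (fireTip_ne h) hρ fun t ht0 htρ => ?_
  rw [rayPt_fireTip h]
  exact hin t ht0 htρ

/-- **The landing point lies on `∂D`.** [folklore] -/
theorem firePt_mem_frontier : firePt D ∈ frontier D.carrier :=
  exitPt_mem_frontier' D.isOpen D.isBounded (fireTip_ne h) (fireExit_pos h)

/-- The landing point is not in `D`. [folklore] -/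
theorem firePt_notMem_carrier : firePt D ∉ D.carrier := fun hq =>
  ((D.isOpen.frontier_eq ▸ firePt_mem_frontier h).2 hq)

/-- The landing point differs from `a`. [folklore] -/
theorem firePt_ne_pt_zero : firePt D ≠ D.pt 0 :=
  rayPt_ne (fireTip_ne h) (fireExit_pos h).ne'

omit h in
/-- Ray points strictly before the exit lie in `D`. [folklore] -/
theorem rayPt_mem_carrier {t : ℝ} (ht0 : 0 < t) (ht : t < fireExit D) :
    rayPt (D.pt 0) (fireTip D) t ∈ D.carrier :=
  rayPt_mem_of_lt ht0 ht

omit h in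
/-- The chord starts at `a`. [folklore] -/
theorem source_fireChord : (fireChord D).source = D.pt 0 := source_chordCurve _
omit h in
/-- The chord ends at the landing point. [folklore] -/
theorem target_fireChord : (fireChord D).target = firePt D := target_chordCurve _

omit h in
/-- Pointwise formula for the chord. [folklore] -/
theorem fireChord_apply (s : I) : fireChord D s = rayPt (D.pt 0) (fireTip D) ((s : ℝ) * fireExit D) := rfl
omit h in
/-- The trace of the chord is the segment `[a, q]`. [folklore] -/
theorem range_fireChord : (fireChord D).range = segment ℝ (D.pt 0) (firePt D) := range_chordCurve _

/-- The chord is injective. [folklore] -/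
theorem injective_fireChord : Function.Injective (fireChord D) :=
  injective_chordCurve (fireTip_ne h) (fireExit_pos h).ne'

/-- **Open chord points lie in `D`.** [folklore] -/
theorem fireChord_mem_carrier {s : I} (hs0 : 0 < (s : ℝ)) (hs1 : (s : ℝ) < 1) :
    fireChord D s ∈ D.carrier := by
  rw [fireChord_apply]
  have hpos := fireExit_pos h
  have hlt : (s : ℝ) * fireExit D < fireExit D := by nlinarith
  exact rayPt_mem_of_lt (mul_pos hs0 hpos) hlt

/-- The chord visits its endpoint `q` only at parameter `1`. [folklore] -/
theorem fireChord_eq_firePt_iff {s : I} : fireChord D s = firePt D ↔ s = 1 := by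
  constructor
  · intro hs
    have : fireChord D s = fireChord D 1 := by rw [hs, ← Curve.target_def, target_fireChord]
    exact injective_fireChord h this
  · rintro rfl
    rw [← Curve.target_def, target_fireChord]

/-- The chord visits `a` only at parameter `0`. [folklore] -/
theorem fireChord_eq_pt_zero_iff {s : I} : fireChord D s = D.pt 0 ↔ s = 0 := by
  constructor
  · intro hs
    have : fireChord D s = fireChord D 0 := by rw [hs, ← Curve.source_def, source_fireChord]
    exact injective_fireChord h this
  · rintro rfl
    rw [← Curve.source_def, source_fireChord]

/-- A chord point on the frontier of `D` is an endpoint. [folklore] -/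
theorem fireChord_mem_frontier_iff {s : I} :
    fireChord D s ∈ frontier D.carrier ↔ s = 0 ∨ s = 1 := by
  constructor
  · intro hs
    by_contra hne
    rw [not_or] at hne
    have hs0 : 0 < (s : ℝ) := lt_of_le_of_ne s.2.1 fun h0 => hne.1 (Subtype.ext h0.symm)
    have hs1 : (s : ℝ) < 1 := lt_of_le_of_ne s.2.2 fun h1 => hne.2 (Subtype.ext h1)
    have hmem := fireChord_mem_carrier h hs0 hs1
    rw [D.isOpen.frontier_eq] at hs
    exact hs.2 hmem
  · rintro (rfl | rfl)
    · rw [← Curve.source_def, source_fireChord]; exact D.pt_mem_frontier 0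
    · rw [← Curve.target_def, target_fireChord]; exact firePt_mem_frontier h

/-- **The chord is a crosscut of `D`** from `a` to `q`. [folklore] -/
theorem isCrosscut_fireChord : D.IsCrosscut (fireChord D).range (D.pt 0) (firePt D) := by
  have hq := firePt_ne_pt_zero h
  refine ⟨?_, D.pt_mem_frontier 0, firePt_mem_frontier h, hq.symm, ?_⟩
  · rw [range_fireChord]
    exact IsSimpleArc.segment hq.symm
  · rintro z ⟨hz, hne⟩
    obtain ⟨s, rfl⟩ := Curve.mem_range.1 hz
    have hs0 : 0 < (s : ℝ) := by
      refine lt_of_le_of_ne s.2.1 fun h0 => hne (Or.inl ?_)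
      rw [(fireChord_eq_pt_zero_iff h).2 (Subtype.ext h0.symm)]
    have hs1 : (s : ℝ) < 1 := by
      refine lt_of_le_of_ne s.2.2 fun h1 => hne (Or.inr ?_)
      rw [(fireChord_eq_firePt_iff h).2 (Subtype.ext h1)]
      exact mem_singleton _
    exact fireChord_mem_carrier h hs0 hs1

end Chord

/-! ### The crosscut domain of a firing Dobrushin domain -/

section Dom

variable {D : DobrushinDomain} (h : Fires D.carrier (D.pt 0)) (hq : firePt D ≠ D.pt 1)

/-- **The crosscut domain** `(D_b; q, b)` of a firing Dobrushin domain whose chord does not land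
at `b`: the `b`-adjacent component of `D ∖ chord`, marks `(q, b)`. [folklore] -/
def fireDom : DobrushinDomain := crosscutDomain (isCrosscut_fireChord h) hq

/-- The first marked point of the crosscut domain is the landing point. [folklore] -/
theorem pt_zero_fireDom : (fireDom h hq).pt 0 = firePt D := pt_zero_crosscutDomain _ _

/-- The second marked point of the crosscut domain is `b`. [folklore] -/
theorem pt_one_fireDom : (fireDom h hq).pt 1 = D.pt 1 := pt_one_crosscutDomain _ _

/-- The crosscut domain lies in `D` off the chord. [folklore] -/
theorem carrier_fireDom_subset : (fireDom h hq).carrier ⊆ D.carrier \ (fireChord D).range :=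
  carrier_crosscutDomain_subset _ _

/-- The frontier of the crosscut domain is `chord ∪ (arc of ∂D through b)`. [folklore] -/
theorem frontier_fireDom :
    frontier (fireDom h hq).carrier = (fireChord D).range ∪ bArc (isCrosscut_fireChord h) hq :=
  frontier_crosscutDomain _ _

/-- The frontier of the crosscut domain lies in `chord ∪ ∂D`. [folklore] -/
theorem frontier_fireDom_subset :
    frontier (fireDom h hq).carrier ⊆ (fireChord D).range ∪ frontier D.carrier :=
  frontier_fireDom h hq ▸ union_subset_union_right _ (bArc_subset_frontier _ _)

/-- The closure of the crosscut domain lies in the closure of `D`. [folklore] -/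
theorem closure_fireDom_subset : closure (fireDom h hq).carrier ⊆ closure D.carrier :=
  closure_crosscutDomain_subset _ _

/-- The typed remaining domain after the chord is the crosscut domain. [folklore] -/
theorem remainingDomain_fireChord :
    remainingDomain D (CurveClass.mk (fireChord D)) = (fireDom h hq).carrier :=
  remainingDomain_eq_crosscutDomain _ _ (CurveClass.range_mk _)

/-! ### The crosscut domain does not re-fire -/

/-- **Segments are Lebesgue-null in the plane.** [folklore] -/
theorem volume_segment (x y : ℂ) : volume (segment ℝ x y) = 0 := by
  -- the segment lies on the affine line through `x` and `y`, a proper affine subspace of `ℂ ≅ ℝ²`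
  rcases eq_or_ne x y with rfl | hxy
  · rw [segment_same]; exact measure_singleton x
  · set Lxy : AffineSubspace ℝ ℂ := AffineSubspace.mk' x (ℝ ∙ (y - x)) with hL
    have hsub : segment ℝ x y ⊆ (Lxy : Set ℂ) := by
      rw [segment_eq_image_lineMap]
      rintro _ ⟨θ, -, rfl⟩
      rw [AffineMap.lineMap_apply_module']
      show θ • (y - x) + x ∈ Lxy
      rw [hL, AffineSubspace.mem_mk', vsub_eq_sub, add_sub_cancel_right]
      exact Submodule.smul_mem _ _ (Submodule.mem_span_singleton_self _)
    have hne : Lxy ≠ ⊤ := by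
      intro htop
      -- `I • (y - x) + x` is not on the real line through `x` and `y`
      have hmem : Complex.I * (y - x) + x ∈ (Lxy : Set ℂ) := by rw [htop]; trivial
      rw [hL] at hmem
      change Complex.I * (y - x) + x ∈ AffineSubspace.mk' x (ℝ ∙ (y - x)) at hmem
      rw [AffineSubspace.mem_mk', vsub_eq_sub, add_sub_cancel_right,
        Submodule.mem_span_singleton] at hmem
      obtain ⟨t, ht⟩ := hmem
      have hyx : y - x ≠ 0 := sub_ne_zero.2 hxy.symm
      have : (t : ℂ) = Complex.I := by
        have e : (t : ℂ) * (y - x) = Complex.I * (y - x) := by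
          rw [← ht, Complex.real_smul]
        exact mul_right_cancel₀ hyx e
      have := congrArg Complex.im this
      simp at this
    exact measure_mono_null hsub (Measure.addHaar_affineSubspace volume Lxy hne)

/-- The trace of the chord is Lebesgue-null. [folklore] -/
theorem volume_range_fireChord : volume (fireChord D).range = 0 := by
  rw [range_fireChord]; exact volume_segment _ _

include h in
/-- Chord points near `q` other than `q`: the ray points `rayPt t`, `t ∈ (τ - r, τ)`, lie on the
open chord, in `ball q r`, and on the frontier of the crosscut domain. [folklore] -/
theorem rayPt_mem_branchSet_fireDom {r t : ℝ} (ht0 : 0 < t) (ht1 : fireExit D - r < t)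
    (ht2 : t < fireExit D) :
    rayPt (D.pt 0) (fireTip D) t ∈ branchSet (fireDom h hq).carrier (firePt D) r := by
  have hne := fireTip_ne h
  have hτ := fireExit_pos h
  rw [mem_branchSet]
  refine ⟨?_, ?_, ?_⟩
  · rw [frontier_fireDom]
    refine Or.inl (Curve.mem_range.2 ⟨⟨t / fireExit D, (div_pos ht0 hτ).le, (div_le_one hτ).2 ht2.le⟩, ?_⟩)
    rw [fireChord_apply]
    congr 1
    simp only
    field_simp
  · rw [firePt, dist_comm, dist_eq_norm, rayPt, rayPt, add_sub_add_left_eq_sub, ← sub_mul, norm_mul,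
      norm_dir hne, mul_one, ← Complex.ofReal_sub, Complex.norm_real, Real.norm_eq_abs,
      abs_of_pos (by linarith)]
    linarith
  · intro heq
    have := rayPt_injective hne heq
    exact ht2.ne this

include h in
/-- **The crosscut domain does not fire at its landing point**: the chord side of `q` is a
Lebesgue-null connected component of the punctured boundary accumulating at `q`. [folklore] -/
theorem not_fires_fireDom : ¬ Fires (fireDom h hq).carrier (firePt D) := by
  have hne := fireTip_ne h
  have hτ := fireExit_pos h
  set q := firePt D with hqdef
  set L := (fireChord D).range with hLdef
  set A := bArc (isCrosscut_fireChord h) hq with hAdef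
  have hdist : 0 < dist q (D.pt 0) := dist_pos.2 (firePt_ne_pt_zero h)
  intro hF
  refine not_fatBothSides_of_null_component (U := (fireDom h hq).carrier) (a := q)
    (lt_min hdist hτ) (fun r hr => ?_) hF.1
  have hrq : r < dist q (D.pt 0) := hr.2.trans_le (min_le_left _ _)
  have hrτ : r < fireExit D := hr.2.trans_le (min_le_right _ _)
  -- a chord point in the punctured boundary at radius `r`
  set t₀ := fireExit D - r / 2 with ht₀
  have ht₀0 : 0 < t₀ := by rw [ht₀]; linarith
  have ht₀1 : fireExit D - r < t₀ := by rw [ht₀]; linarith [hr.1]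
  have ht₀2 : t₀ < fireExit D := by rw [ht₀]; linarith [hr.1]
  set x := rayPt (D.pt 0) (fireTip D) t₀ with hx
  have hxB := rayPt_mem_branchSet_fireDom h hq ht₀0 ht₀1 ht₀2
  set B := branchSet (fireDom h hq).carrier q r with hB
  set C := connectedComponentIn B x with hC
  refine ⟨x, hxB, L, volume_range_fireChord, ?_, ?_⟩
  · -- `q` is in the closure of the component: the component contains the final open piece of the chord
    set P := rayPt (D.pt 0) (fireTip D) '' Ioo (fireExit D - r) (fireExit D) with hP
    have hPB : P ⊆ B := by
      rintro _ ⟨t, ht, rfl⟩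
      exact rayPt_mem_branchSet_fireDom h hq (by linarith [ht.1]) ht.1 ht.2
    have hPconn : IsPreconnected P := isPreconnected_Ioo.image _ continuous_rayPt.continuousOn
    have hxP : x ∈ P := ⟨t₀, ⟨ht₀1, ht₀2⟩, rfl⟩
    have hPC : P ⊆ C := hPconn.subset_connectedComponentIn hxP hPB
    refine closure_mono hPC ?_
    have htend : Tendsto (rayPt (D.pt 0) (fireTip D)) (𝓝[<] fireExit D) (𝓝 q) :=
      (continuous_rayPt (a := D.pt 0) (m := fireTip D)).continuousAt.tendsto.mono_left nhdsWithin_le_nhds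
    refine mem_closure_of_tendsto htend ?_
    filter_upwards [Ioo_mem_nhdsLT (show fireExit D - r < fireExit D by linarith [hr.1])] with t ht
    exact ⟨t, ht, rfl⟩
  · -- the component lies on the chord: `B ⊆ L ∪ A` with `L`, `A` closed and disjoint inside `B`
    have hBsub : B ⊆ L ∪ A := fun z hz => by
      have := hz.1.1
      rw [frontier_fireDom] at this
      exact this
    have hCsub : C ⊆ L ∪ A := (connectedComponentIn_subset _ _).trans hBsub
    have hLcl : IsClosed L := (fireChord D).isCompact_range.isClosed
    have hAcl : IsClosed A := (isSimpleArc_bArc _ _).isCompact.isClosed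
    have hdisj : C ∩ (L ∩ A) = ∅ := by
      ext z
      simp only [mem_inter_iff, mem_empty_iff_false, iff_false, not_and]
      intro hzC hzL hzA
      have hzB : z ∈ B := connectedComponentIn_subset _ _ hzC
      -- points of `L ∩ ∂D` are the endpoints `a`, `q`
      have hzfr : z ∈ frontier D.carrier := bArc_subset_frontier _ _ hzA
      obtain ⟨s, rfl⟩ := Curve.mem_range.1 hzL
      rcases (fireChord_mem_frontier_iff h).1 hzfr with rfl | rfl
      · -- `z = a` is too far from `q`
        have hza : fireChord D 0 = D.pt 0 := by rw [← Curve.source_def, source_fireChord]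
        have hd := hzB.1.2
        rw [hza, mem_ball, dist_comm] at hd
        exact absurd hd (not_lt.2 hrq.le)
      · -- `z = q` is excluded from the punctured boundary
        have hzq : fireChord D 1 = q := by rw [← Curve.target_def, target_fireChord]
        exact hzB.2 hzq
    rcases (isPreconnected_iff_subset_of_disjoint_closed.1 isPreconnected_connectedComponentIn)
      L A hLcl hAcl hCsub hdisj with hCL | hCA
    · exact hCL
    · -- impossible: `x ∈ C` is an open chord point, not on `∂D ⊇ A`
      exfalso
      have hxC : x ∈ C := mem_connectedComponentIn hxB
      have hxfr : x ∈ frontier D.carrier := bArc_subset_frontier _ _ (hCA hxC)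
      have hxD : x ∈ D.carrier := rayPt_mem_carrier ht₀0 ht₀2
      rw [D.isOpen.frontier_eq] at hxfr
      exact hxfr.2 hxD

end Dom

end Summit.CriticalPhenomena.CardyFormulaZ2.Theorems.CardyRotToConfR2SymmetryUpgrade.Negative

end
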